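import Summits.BirchSwinnertonDyer.BirchSwinnertonDyer.Theorems.UniversalToricDescentTwinReadoutIndexOfLocalClauses
import Summits.BirchSwinnertonDyer.BirchSwinnertonDyer.Theorems.UniversalToricDescentTwinReadoutLocalIndexThreeUnconditional
import Summits.BirchSwinnertonDyer.BirchSwinnertonDyer.Theorems.PrintX10bStubReadoutLocalOff
import Summits.BirchSwinnertonDyer.BirchSwinnertonDyer.Theorems.PrintX10bStubReadoutLocalIndexBad
import Summits.BirchSwinnertonDyer.BirchSwinnertonDyer.Theorems.PrintX10bStubReadoutLocalIndexP
import HarnessLib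

/-!
# (B5) and the control glue for the twin AT `p = 3`, UNCONDITIONALLY: `readoutIndexMultAt_three`, `controlGlueMultAt_three`
# (helper, THEOREMS ONLY: no definition, no named fact, no instance, no `sorry`)

Summits-side helper toward the registered stub `stub_howardOutputsOfFamily` (K2) of line `beta-road` (skeleton v10
cd44fe9d5c6b9a78) of crux r205 stmt-BirchSwinnertonDyer-24737 `…Theses.UniversalToricDescent.TwinAlgMuZeroAtThree` (LEAD
lineage `bsd-wall-utd-p1`, g26; `--supports`).  ROUTE-INDEPENDENT.

The three place-wise clauses of the m-UNIFORM index bound (B5) on the TWIN FRAME (`…TwinReadoutIndexOfLocalClauses`):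
* **`readoutLocalOffMultAt_holds p`** — (B5-OFF) at every prime: x9-p2 g6's `stub_readoutLocalOff` re-framed (its per-place
  lemma `HeegnerMuPartControlGlue.localization_mem_eisensteinSelmerStructure_of_eisensteinTowerReadout_mem_selmerInfty` is
  generic; `γ := hγ`); «no contribution at the good places».
* **`readoutLocalIndexBadMultAt_holds p`** — (B5-BAD) at every prime: x10b-p2 g8's `stub_readoutLocalIndexBad` re-framed
  (`Fv := ⊤`, `c := 8 p^e`; finitely decomposed places above `N` by (Heeg) + Brink, prime-to-`p` local Euler characteristic).
* **`readoutLocalIndexPMultAt_three`** — (B5-P) at `p = 3`: x10b-p1-w7's wrapper `stub_readoutLocalIndexP_of_principalShift`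
  re-framed around g25/g26's per-place theorem `UniversalToricDescentTwinReadoutLocalIndexThreeUnconditional.
  readoutLocalIndexThree_at_of_hasMultiplicativeReductionAt_unconditional` (p763986: the relaxed level-shifted condition at a
  MULTIPLICATIVE `v ∣ 3`, index `≤ 3^{2·3^s}`, its (hS′) input discharged by the Kummer = strict theorem p763643/p763326).
Hence **`readoutIndexMultAt_three : Stmt.readoutIndexMultAt 3`** (by `readoutIndexMultAt_of_localClauses`) and
**`controlGlueMultAt_three : Stmt.controlGlueMultAt 3`** (by `controlGlueMultAt_of_readoutIndexMultAt`, (B4) being the theorem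
`readoutSelmerMult_holds`): x10b's `stub_controlGlue` for curves over `ℚ` with MULTIPLICATIVE reduction at `3`, imaginary
quadratic `K` Heegner for `N`, anticyclotomic `κ`, `E(K)[3] = 0` — with NO letter, NO named fact and NO (CG) leaf left: for
`𝔖 = D.S` f.g., `z ≠ 0` with `𝔖/Λz` torsion, m-UNIFORM `c, m₁` such that Howard's `Conclusion` for `S_m` at the control levels
of `z` yields a `SpecWitness (𝔖, X, Λz, q_m, 3^c)` for every `m ≥ m₁` and every admissible datum.  What this is NOT: Howard's
`Conclusion` for the twin (Kolyvagin system at `3 ∥ N′` beyond print + Thm. 1.6.1 = F-161′), the outputs (H-i′)/(H-ii) of the K2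
stub, K1, C₀.  No summit statement is proved; BSD is not proved by any of this.

References: [Howard2004HeegnerKolyvagin] Lemma 2.2.7, Prop. 2.2.8 and proof of Thm. 2.2.10 (𝔮 = T^m + p); [GreenbergLNM1716]
§2 p. 76, Prop. 2.1, §3 Lemma 3.3, §4; [MilneADT2006] I Thm. 2.8; [Brink2007] Thm. 2, Cor. 1.
-/

set_option linter.dupNamespace false
set_option autoImplicit false

noncomputable section

open scoped Classical Pointwise ContRepresentation TensorProduct NumberField

open Function NumberField IsDedekindDomain Field
open Literature Literature.NumberTheory.EllipticCurves WeierstrassCurve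
open Literature.NumberTheory.GaloisCohomology Literature.NumberTheory.GaloisCohomology.Howard2004
open Literature.NumberTheory.GaloisRepresentations Literature.NumberTheory.GaloisRepresentations.DiscreteGaloisModule
open Literature.NumberTheory.EllipticCurves.GreenbergSelmer
open Summit.BirchSwinnertonDyer.BirchSwinnertonDyer.Theorems
open Summit.BirchSwinnertonDyer.BirchSwinnertonDyer.Theorems.UniversalToricDescentTwinControlGlue

namespace Summit.BirchSwinnertonDyer.BirchSwinnertonDyer.Theorems.UniversalToricDescentTwinReadoutIndex

/-! ## §1 (B5-OFF) at every prime -/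

set_option maxHeartbeats 400000 in
set_option synthInstance.maxHeartbeats 80000 in
/-- **Letter (B5-OFF) on the twin frame holds** (`m₁ := 0`, `j₀ := 0`): for every admissible Eisenstein datum, every tower
level `j`, every class `c ∈ H¹(K, T_j)` whose readout lies in `Sel_{p^∞}(E/K_∞)` and every finite `v ∉ S`,
`loc_v c ∈ condA F_𝔮 (j, v)` — indeed `loc_v c ∈ F_𝔮(j, v)` (x9-p2's per-place lemma with `γ := hγ`; `v ∤ p` by `hpS`, good
reduction by `hbad`), the `d = 0` term of the directed union `condA`.  The frame hypotheses beyond `hγ` are not used.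
[cite: Howard2004HeegnerKolyvagin, Def. 2.1.10, Lemma 2.2.7 / Prop. 2.2.8 and proof of Thm. 2.2.10 (arXiv p. 17 L41–53)]
[cite: GreenbergLNM1716, §2 Prop. 2.1 and §4 pp. 107, 124] [cite: GreenbergVatsal2000, §2 p. 17] -/
theorem readoutLocalOffMultAt_holds (p : ℕ) [Fact p.Prime] : Stmt.readoutLocalOffMultAt p := by
  intro N _ W _ _ K _ _ κ γ _hK _hp2 _hκ _hHeeg hγ _hE _hmultp
  refine ⟨0, fun m hm _ ↦ ?_⟩
  letI := IwasawaAlgebra.isDomain_quotient_X_pow_add_C p hm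
  letI := IwasawaAlgebra.isDiscreteValuationRing_quotient_X_pow_add_C p hm
  haveI := IwasawaAlgebra.EisensteinCoeff.isLocalRing_succ p hm
  letI := IwasawaAlgebra.EisensteinCoeff.algebraOfSpecSucc p m
  haveI := W.isScalarTower_algebraOfSpecSucc (K := K) (p := p) (m := m)
  letI := W.residueModuleSucc (K := K) (p := p) hm
  intro S hpS hbad _hSN _hSσ L hL hLS jbar' cd Dd fs hy hπ he hπX hek
  refine ⟨0, fun j _ c hc v hvS ↦ ?_⟩
  have hpv : ((p : ℕ) : 𝓞 K) ∉ v.asIdeal := fun h ↦ hvS (hpS v h)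
  -- `F ≤ condA F`: the `d = 0` term of the directed union
  unfold AdicTower.condA
  refine AddSubgroup.mem_iSup_of_mem 0 ?_
  rw [AddSubgroup.mem_comap]
  exact HeegnerMuPartControlGlue.localization_mem_eisensteinSelmerStructure_of_eisensteinTowerReadout_mem_selmerInfty W κ
    hm _ _ hy.killed hy.ker_red hπ he hπX hek hγ S hbad v hvS hpv j c hc

/-! ## §2 (B5-BAD) at every prime -/

set_option maxHeartbeats 400000 in
set_option synthInstance.maxHeartbeats 80000 in
/-- **Letter (B5-BAD) on the twin frame holds, with `Fv := ⊤`**: `c := 8 p^e`, `m₁ := 2 p^e + 1`, `j₀ := 0`, `p^e` one exact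
value of `κ⁻¹` on `Γ_{K_v}` for all `v ∣ N`, `v ∤ p` (finitely decomposed in `K_∞` by (Heeg) + Brink); the index bound is
`#(⊤ ⧸ condA F j v) ≤ #H¹(K_v, T^{(j)}) ≤ p^{8 p^e}` (prime-to-`p` local Euler characteristic, uniform in `m` and `j`).
[cite: Howard2004HeegnerKolyvagin, Lemma 2.2.7 / Prop. 2.2.8 and proof of Thm. 2.2.10 (𝔮 = T^m + p)] [cite: MilneADT2006, I Thm. 2.8]
[cite: Brink2007, Thm. 2 and Cor. 1] -/
theorem readoutLocalIndexBadMultAt_holds (p : ℕ) [Fact p.Prime] : Stmt.readoutLocalIndexBadMultAt p := by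
  intro N _ W _ _ K _ _ κ γ hK _hp2 hκ hHeeg _hγ _hE _hmultp
  have hN0 : N ≠ 0 := NeZero.ne N
  -- one exponent `e` for `κ⁻¹ = κ.unitTwist (-1)` over the places above `N` away from `p`
  have hdec : ∀ v : HeightOneSpectrum (𝓞 K), ((N : ℕ) : 𝓞 K) ∈ v.asIdeal → ((p : ℕ) : 𝓞 K) ∉ v.asIdeal →
      ¬ (GreenbergSelmer.decomp v ≤ κ.kerSubgroup) := fun v hNv hpv ↦
    ZpExtension.decomp_not_le_kerSubgroup_of_natCast_mem_of_satisfiesHeegnerHypothesis hK κ hκ hHeeg hN0 v hpv hNv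
  obtain ⟨e, he⟩ := ZpExtension.exists_forall_toAdd_apply_absGaloisRestrict_eq_pow_of_natCast_mem κ hN0 hdec
  refine ⟨8 * p ^ e, 2 * p ^ e + 1, fun m hm hm₁ ↦ ?_⟩
  letI := IwasawaAlgebra.isDomain_quotient_X_pow_add_C p hm
  letI := IwasawaAlgebra.isDiscreteValuationRing_quotient_X_pow_add_C p hm
  haveI := IwasawaAlgebra.EisensteinCoeff.isLocalRing_succ p hm
  letI := IwasawaAlgebra.EisensteinCoeff.algebraOfSpecSucc p m
  haveI := W.isScalarTower_algebraOfSpecSucc (K := K) (p := p) (m := m)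
  letI := W.residueModuleSucc (K := K) (p := p) hm
  intro S hpS hbad hSN hSσ L hL hLS jbar' cd Dd fs hy hπ he' hπX hek
  refine ⟨0, fun j _ v hvS hpv ↦ ?_⟩
  obtain ⟨h, hh⟩ := he v ((hSN v hvS).resolve_left hpv) hpv
  have hh' : ((κ.unitTwist (-1)) (absGaloisRestrict K (v.adicCompletion K) h⁻¹)).toAdd = ((p ^ e : ℕ) : ℤ_[p]) := by
    rw [ZpExtension.unitTwist_apply, toAdd_ofAdd, map_inv, map_inv, toAdd_inv, hh, Units.val_neg, Units.val_one,
      neg_one_mul, neg_neg]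
  refine ⟨⊤, fun c _ ↦ AddSubgroup.mem_top _, ?_⟩
  exact W.finite_and_natCard_top_quotient_le_pow_eisensteinTower κ hm v hpv h⁻¹ (Nat.one_le_pow _ _ (Fact.out : p.Prime).pos)
    hh' (by omega) j _

/-! ## §3 (B5-P) at `p = 3`: the multiplicative places -/

set_option maxHeartbeats 1600000 in
set_option synthInstance.maxHeartbeats 80000 in
/-- **Letter (B5-P) on the twin frame holds at `p = 3`**: at the places `v ∣ 3` (MULTIPLICATIVE for the twin), for `m ≥ 3^s + 1`
(`3^s` one exact value of `κ⁻¹` on `Γ_{K_v}` for all `v ∣ 3`, finitely decomposed by anticyclotomicity), every admissible Eisenstein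
datum and every tower level `j`, the relaxed level-shifted condition `Fv ∋ loc_v c` of p763986 for every class `c` with readout in
`Sel_{3^∞}(E/K_∞)`, with `#(Fv ⧸ condA_j(v) ∩ Fv) ≤ 3^{2·3^s}` — `c := 2·3^s` independent of `m`, `j` and the datum.  x10b's
wrapper around the per-place theorem at a multiplicative place (Kummer = Greenberg-strict for `C_v = E[3^∞] ∩ E₁`, proved).
[cite: Howard2004HeegnerKolyvagin, Lemma 2.2.7 / Prop. 2.2.8, Lemma 3.2.7 and proof of Thm. 2.2.10 (𝔮 = T^m + p)]
[cite: GreenbergLNM1716, §2 p. 76 and §2–§4] [cite: Brink2007, Cor. 1] -/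
theorem readoutLocalIndexPMultAt_three : Stmt.readoutLocalIndexPMultAt 3 := by
  intro N _ W _ _ K _ _ κ γ hK _hp2 hκ _hHeeg hγ _hE hmultp
  -- every `v ∣ 3` is finitely decomposed in `K_∞` (anticyclotomic), for `κ⁻¹ = κ.unitTwist (-1)`; one exponent `s` for all
  have hdec : ∀ v : HeightOneSpectrum (𝓞 K), ((3 : ℕ) : 𝓞 K) ∈ v.asIdeal →
      ¬ (GreenbergSelmer.decomp v ≤ (κ.unitTwist (-1)).kerSubgroup) := fun v hpv ↦ by
    rw [ZpExtension.kerSubgroup_unitTwist]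
    exact ZpExtension.decomp_not_le_kerSubgroup_above_of_isAnticyclotomic_anyPrime K 3 hK κ hκ v hpv
  obtain ⟨s, hs⟩ := HeegnerMuPartControlGlue.exists_forall_toAdd_apply_absGaloisRestrict_eq_pow_of_mem (κ.unitTwist (-1)) hdec
  refine ⟨2 * 3 ^ s, 3 ^ s + 1, fun m hm hm₁ ↦ ?_⟩
  letI := IwasawaAlgebra.isDomain_quotient_X_pow_add_C 3 hm
  letI := IwasawaAlgebra.isDiscreteValuationRing_quotient_X_pow_add_C 3 hm
  haveI := IwasawaAlgebra.EisensteinCoeff.isLocalRing_succ 3 hm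
  letI := IwasawaAlgebra.EisensteinCoeff.algebraOfSpecSucc 3 m
  haveI := W.isScalarTower_algebraOfSpecSucc (K := K) (p := 3) (m := m)
  letI := W.residueModuleSucc (K := K) (p := 3) hm
  intro S hpS hbad hSN hSσ L hL hLS jbar' cd Dd fs hy hπ he' hπX hek
  refine ⟨0, fun j _ v _hvS hpv ↦ ?_⟩
  have hms : 3 ^ s < m := by omega
  obtain ⟨σ₀, hσ₀⟩ := hs v hpv
  -- the per-place theorem on the setting's tower (`St.T = eisensteinTower`, `St.t_k.cond (inr v) = F_𝔮(v)_{k+1}` by `rfl`)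
  exact UniversalToricDescentTwinReadoutLocalIndexThreeUnconditional.readoutLocalIndexThree_at_of_hasMultiplicativeReductionAt_unconditional
    W κ hγ hm _ _ hy.killed hy.ker_red hπ he' hπX hek _ v hpv (hmultp v hpv) σ₀ hσ₀ hms j
    (fun k ↦ (congrFun (W.eisensteinDVRSetting_t_cond (κ.unitTwist (-1)) hm S hpS hbad L hL hLS jbar' cd Dd fs k)
      (Sum.inr v)).trans (ZpExtension.eisensteinSelmerStructure_inr_of_mem _ _ _ _ _ _ _ hpv))

/-! ## §4 (B5) and the control glue at `p = 3` -/

/-- **(B5) `Stmt.readoutIndexMultAt 3` HOLDS** — the m-UNIFORM index bound of the discrete control for curves over `ℚ` with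
multiplicative reduction at `3` on the twin frame, from its three place-wise clauses (§1–§3) by `readoutIndexMultAt_of_localClauses`.
[cite: Howard2004HeegnerKolyvagin, Prop. 2.2.8 (second map) and proof of Thm. 2.2.10 (𝔮 = T^m + p)] -/
theorem readoutIndexMultAt_three : Stmt.readoutIndexMultAt 3 :=
  readoutIndexMultAt_of_localClauses (readoutLocalOffMultAt_holds 3) readoutLocalIndexPMultAt_three
    (readoutLocalIndexBadMultAt_holds 3)

/-- **The control glue `Stmt.controlGlueMultAt 3` HOLDS** — x10b's `stub_controlGlue` on the twin frame at `p = 3` with no letter,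
no named fact and no (CG) leaf left: (B4) is `readoutSelmerMult_holds` (p764670), (B5) is `readoutIndexMultAt_three`.
[cite: Howard2004HeegnerKolyvagin, Thm. 1.6.1, Prop. 2.2.8 and proof of Thm. 2.2.10 (𝔮 = T^m + p)] -/
theorem controlGlueMultAt_three : Stmt.controlGlueMultAt 3 :=
  controlGlueMultAt_of_readoutIndexMultAt readoutIndexMultAt_three

end Summit.BirchSwinnertonDyer.BirchSwinnertonDyer.Theorems.UniversalToricDescentTwinReadoutIndex

end
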